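import Summits.CriticalPhenomena.PercolationContinuityZ3.Theorems.PercNearOneGluingNoHeavyLowerTailMergeStability
import HarnessLib

/-!
# `NoHeavyLowerTail` (stmt-CriticalPhenomena-4575) — the ATTACHED-CHAMPION inequality (XZ) and its reductions

Lead of the crux (route `PercNearOneGluingNoHeavy`), 2026-08-18.  Bond percolation `μ = prodBernoulli w` on
`Fin n`, relays `A`, observer `o ∉ A`, level `j`; `π(v) = {x ∈ A : v ↔ x}`, `N = |π(o)|`, `R_a = {|π(a)| ≤ j}`,
`L = {1 ≤ N ≤ j}`, and `𝔸 = {o ↔ A} = {1 ≤ N}` ("`o` is attached").  A CHAMPION at level `j` is a relay `q`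
with `μ(R_a) ≤ μ(R_q)` for every `a ∈ A`.

**The attached-champion inequality (hypothesis `hAC` below; conjecture, lead's census 2026-08-18).**
For every weighted graph, every `A`, `o ∉ A`, `j` and every champion `q`:

  `μ(1 ≤ N ≤ j) ≤ μ(|π(q)| ≤ j ∧ 1 ≤ N)`,     i.e.   `P(L) ≤ P(R_q ∩ 𝔸)`.

Equivalent forms (subtract the common event `L ∩ R_q`; on `{o ↔ q}` the two blocks coincide):
`μ(1 ≤ N ≤ j < |π(q)|) ≤ μ(|π(q)| ≤ j < N)` ("`o` light⁺ & `q` heavy ≤ `q` light & `o` heavy"), or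
`P(N ≤ j | o ↔ A) ≤ P(|π(q)| ≤ j | o ↔ A)`: given that the observer is attached, its block is no more likely to be
small than the champion's.  It sharpens the cumulative isolation lemma `stub_cumulativeIsolation`
(`P(L) ≤ P(R_q)`) by the Harris gap `P(R_q) − P(R_q ∩ 𝔸) ≥ 0`, is an IDENTITY at level `j = |A| − 1`, is tight
exactly on the glued locus (`o` a.s. joined to a champion), and for RELAYS in place of `o` it is the trivial
rearrangement of `μ(R_a) ≤ μ(R_q)`.  Census (lab/t_xz*.py, exact enumeration): 0 violations in ≈ 1.3·10⁴ (graph,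
level, champion) cases, random weighted graphs `n ≤ 9` incl. sparse / near-glued / Steiner-neighbour regimes, the
structured families that killed LR(5,2) and WPE (o glued to a relay + sparse `K₅`, stars with a co-located relay,
blob chains), and coordinate hill-climbs on the ratio (sup = 1⁻, attained only in the glued limit).  Proved cases
(paper, this seat): level `j = 1` (Kozma–Nitzan's Lemma 2 chain with one more BHK step:
`P(N = 1) ≤ P(π(q) = {q}, o ↔ A)`), and every observer whose positive-weight neighbours are relays (cluster-hit
decomposition + `Literature…observerSet_le_of_lonelier`).

This file records the (trivial) reductions: `hAC ⇒ stub_cumulativeIsolation ⇒ NoHeavyLowerTail`.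
-/

noncomputable section

namespace Summit.CriticalPhenomena.PercolationContinuityZ3.Theorems

open MeasureTheory Set Literature.Probability.LatticeModels Literature.Probability.Percolation
open scoped Classical BigOperators

open MergeStability in
/-- **The attached-champion inequality implies the cumulative isolation lemma (all levels).**  Hypothesis
`hAC` = the registered stub `stub_attachedChampion` (XZ); conclusion = the registered stub
`stub_cumulativeIsolation`.  Proof: take a champion `q` (`MergeStability.exists_champion`) and drop `𝔸`. -/
theorem cumulativeIsolation_of_attachedChampion
    (hAC : ∀ (n : ℕ) (w : Sym2 (Fin n) → unitInterval) (A : Finset (Fin n)) (o q : Fin n) (j : ℕ),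
      o ∉ A → q ∈ A →
      (∀ a ∈ A,
        (Literature.Probability.LatticeModels.prodBernoulli w).real
            {ω : Literature.Probability.Percolation.BondConfig (Fin n) |
              (A.filter fun x => ω ∈ Literature.Probability.Percolation.openConn a x).card ≤ j} ≤
          (Literature.Probability.LatticeModels.prodBernoulli w).real
            {ω : Literature.Probability.Percolation.BondConfig (Fin n) |
              (A.filter fun x => ω ∈ Literature.Probability.Percolation.openConn q x).card ≤ j}) →
      (Literature.Probability.LatticeModels.prodBernoulli w).real
          {ω : Literature.Probability.Percolation.BondConfig (Fin n) |
            1 ≤ (A.filter fun x => ω ∈ Literature.Probability.Percolation.openConn o x).card ∧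
              (A.filter fun x => ω ∈ Literature.Probability.Percolation.openConn o x).card ≤ j} ≤
        (Literature.Probability.LatticeModels.prodBernoulli w).real
          {ω : Literature.Probability.Percolation.BondConfig (Fin n) |
            (A.filter fun x => ω ∈ Literature.Probability.Percolation.openConn q x).card ≤ j ∧
              1 ≤ (A.filter fun x => ω ∈ Literature.Probability.Percolation.openConn o x).card})
    (n : ℕ) (w : Sym2 (Fin n) → unitInterval) (A : Finset (Fin n)) (o : Fin n) (j : ℕ)
    (hA : A.Nonempty) (ho : o ∉ A) :
    ∃ a ∈ A,
      (Literature.Probability.LatticeModels.prodBernoulli w).real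
          {ω : Literature.Probability.Percolation.BondConfig (Fin n) |
            1 ≤ (A.filter fun x => ω ∈ Literature.Probability.Percolation.openConn o x).card ∧
              (A.filter fun x => ω ∈ Literature.Probability.Percolation.openConn o x).card ≤ j} ≤
        (Literature.Probability.LatticeModels.prodBernoulli w).real
          {ω : Literature.Probability.Percolation.BondConfig (Fin n) |
            (A.filter fun x => ω ∈ Literature.Probability.Percolation.openConn a x).card ≤ j} := by
  obtain ⟨q, hq, hchamp⟩ := exists_champion (prodBernoulli w) A hA j
  refine ⟨q, hq, (hAC n w A o q j ho hq hchamp).trans ?_⟩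
  exact measureReal_mono (fun ω hω => hω.1) (measure_ne_top _ _)

/-- **The attached-champion inequality closes the crux `NoHeavyLowerTail`** (route `PercNearOneGluing` decl),
through `cumulativeIsolation_of_attachedChampion` and the landed
`noHeavyLowerTail_of_stub_cumulativeIsolation`. -/
theorem noHeavyLowerTail_of_attachedChampion
    (hAC : ∀ (n : ℕ) (w : Sym2 (Fin n) → unitInterval) (A : Finset (Fin n)) (o q : Fin n) (j : ℕ),
      o ∉ A → q ∈ A →
      (∀ a ∈ A,
        (Literature.Probability.LatticeModels.prodBernoulli w).real
            {ω : Literature.Probability.Percolation.BondConfig (Fin n) |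
              (A.filter fun x => ω ∈ Literature.Probability.Percolation.openConn a x).card ≤ j} ≤
          (Literature.Probability.LatticeModels.prodBernoulli w).real
            {ω : Literature.Probability.Percolation.BondConfig (Fin n) |
              (A.filter fun x => ω ∈ Literature.Probability.Percolation.openConn q x).card ≤ j}) →
      (Literature.Probability.LatticeModels.prodBernoulli w).real
          {ω : Literature.Probability.Percolation.BondConfig (Fin n) |
            1 ≤ (A.filter fun x => ω ∈ Literature.Probability.Percolation.openConn o x).card ∧
              (A.filter fun x => ω ∈ Literature.Probability.Percolation.openConn o x).card ≤ j} ≤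
        (Literature.Probability.LatticeModels.prodBernoulli w).real
          {ω : Literature.Probability.Percolation.BondConfig (Fin n) |
            (A.filter fun x => ω ∈ Literature.Probability.Percolation.openConn q x).card ≤ j ∧
              1 ≤ (A.filter fun x => ω ∈ Literature.Probability.Percolation.openConn o x).card}) :
    Summit.CriticalPhenomena.PercolationContinuityZ3.Theses.PercNearOneGluing.NoHeavyLowerTail :=
  noHeavyLowerTail_of_stub_cumulativeIsolation fun n w A o j hA ho =>
    cumulativeIsolation_of_attachedChampion hAC n w A o j hA ho

end Summit.CriticalPhenomena.PercolationContinuityZ3.Theorems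

end
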